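import Literature.Geometry.Kaehler.LelongComparison
import Literature.Geometry.Kaehler.PlaneMongeAmpere
import Literature.Geometry.Kaehler.ChainProjectionFormula
import Literature.Geometry.Kaehler.HolomorphicChainRectifiableHolds
import Literature.Geometry.Kaehler.MatrixFormAlgebra
import HarnessLib

/-!
# The Lelong number of an analytic set is the multiplicity of a good projection

Let `A ⊆ Ω` be analytic of pure dimension `p = q + 1`, `a ∈ A`, and `ℓ : V → K` (`dim K = p`) a
complex-linear projection such that, on an open tube `U ∋ a`, (i) the **cone condition**
`‖z - a‖ ≤ C₀ ‖ℓ(z - a)‖` holds on `A ∩ U`, (ii) `[A]` is a `k`-sheeted cover over the good points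
of the base (`HolomorphicChain.IsSheetedOver`, `ChainProjectionFormula.lean`,
`ChainProjectionCover.lean`), so that the Monge–Ampère mass of every cylindrical profile weight
`g(log ‖ℓ z - ℓ a‖)` over `reg A ∩ U ∩ ℓ⁻¹ B(ℓ a, ρ₁)` is `k · p! 2ᵖ · c(2p)`
(`setIntegral_twoPow_ddcForm_cyl_eq`, from the projection formula and `PlaneMongeAmpere.lean`),
and (iii) `reg A ∩ U` is proper over the base. Let `Λ = lim 𝓗^{2p}(A ∩ B(a,r))/r^{2p}` be the
(un-normalised) Lelong number (`LelongNumberExists.lean`, `exists_lelong_data`). Then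

* `Λ ≤ l'ᵖ k c(2p)` for every `l' > 1` (`lelong_le_mul_sheets`), and
* `k c(2p) ≤ l'ᵖ (W(ρ) + Λ)` for every `l' > 1` and every small `ρ` (`sheets_le_mul_lelong`),

whence `Λ = k · c(2p)`, i.e. **`n(A, a) = μ_a(ℓ|_A) = k ∈ ℕ`, `k ≥ 1`** [Chirka1989, §15.1 Prop. 2].
Both inequalities are the comparison inequality `setIntegral_twoPow_ddcForm_le_of_comparison`
(`LelongComparison.lean`) for the regularised maximum of a radial and a (scaled, shifted)
cylindrical profile weight, the constants being chosen so that the maximum is the radial weight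
near the centre / the sphere and the cylindrical weight near the rim of the tube / over the small
base ball — Demailly's proof of the comparison theorem for Lelong numbers with the weights
`log ‖z - a‖` and `log ‖ℓ(z - a)‖` [Demailly, *Complex analytic and differential geometry*,
Ch. III Thm. 7.1, Thm. 7.7, Cor. 7.8].

## References

* E. M. Chirka, *Complex Analytic Sets*, Kluwer 1989, §15.1 Prop. 2, p. 190 [Chirka1989].
* J.-P. Demailly, *Complex analytic and differential geometry*, Ch. III §7.
-/

noncomputable section

open scoped Manifold Topology ENNReal InnerProductSpace ContDiff
open Set Filter MeasureTheory Metric Module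

universe u

namespace Literature.Geometry.Kaehler

open Literature.Geometry.GeometricMeasureTheory Literature.Analysis.Pluripotential TwoForm

variable {V : Type u} [NormedAddCommGroup V] [InnerProductSpace ℂ V]

/-! ### Scaling of Monge–Ampère densities -/

section Scaling

/-- **`(c a)ᵖ = cᵖ aᵖ`** for the wedge powers of a `2`-form. [folklore] -/
theorem twoPow_smul (c : ℝ) (a : V [⋀^Fin 2]→L[ℝ] ℝ) (p : ℕ) : (c • a).twoPow p = c ^ p • a.twoPow p := by
  induction p with
  | zero => rw [ContinuousAlternatingMap.twoPow_zero, ContinuousAlternatingMap.twoPow_zero, pow_zero, one_smul]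
  | succ p ih =>
    rw [ContinuousAlternatingMap.twoPow_succ, ContinuousAlternatingMap.twoPow_succ, ih,
      ContinuousAlternatingMap.algebra_smul_wedge, ContinuousAlternatingMap.wedge_algebra_smul, smul_smul,
      ← pow_succ, ContinuousAlternatingMap.domDomCongr_smul]

/-- **`dd^c (l u + c) = l dd^c u`** for `u` of class `C²`. [folklore] -/
theorem ddcForm_const_mul_add_const {u : V → ℝ} (hu : ContDiff ℝ 2 u) (l c : ℝ) (z : V) :
    ddcForm (fun y => l * u y + c) z = l • ddcForm u z := by
  have hu2 : DifferentiableAt ℝ (fderiv ℝ u) z :=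
    ((hu.fderiv_right (m := 1) le_rfl).differentiable one_ne_zero).differentiableAt
  have hlu : ContDiff ℝ 2 fun y => l * u y + c := (contDiff_const.mul hu).add contDiff_const
  have hlu2 : DifferentiableAt ℝ (fderiv ℝ fun y => l * u y + c) z :=
    ((hlu.fderiv_right (m := 1) le_rfl).differentiable one_ne_zero).differentiableAt
  ext v
  rw [ddcForm_apply hlu2, fderiv_fderiv_const_mul_add_const hu, ContinuousAlternatingMap.smul_apply,
    ddcForm_apply hu2]
  change l * fderiv ℝ (fderiv ℝ u) z (v 1) (Complex.I • v 0) - l * fderiv ℝ (fderiv ℝ u) z (v 0) (Complex.I • v 1) =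
    l • (fderiv ℝ (fderiv ℝ u) z (v 1) (Complex.I • v 0) - fderiv ℝ (fderiv ℝ u) z (v 0) (Complex.I • v 1))
  rw [smul_eq_mul]
  ring

/-- **`(dd^c (l u + c))ᵖ(ξ) = lᵖ (dd^c u)ᵖ(ξ)`**. [folklore] -/
theorem twoPow_ddcForm_const_mul_add_const_apply {u : V → ℝ} (hu : ContDiff ℝ 2 u) (l c : ℝ) (z : V)
    (p : ℕ) (ξ : Fin (2 * p) → V) :
    (ddcForm (fun y => l * u y + c) z).twoPow p ξ = l ^ p * (ddcForm u z).twoPow p ξ := by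
  rw [ddcForm_const_mul_add_const hu, twoPow_smul, ContinuousAlternatingMap.smul_apply, smul_eq_mul]

end Scaling

variable [FiniteDimensional ℂ V] [MeasurableSpace V] [BorelSpace V] {Ω : TopologicalSpace.Opens V} {q : ℕ}

namespace HolomorphicChain

/-! ### Integrability of Monge–Ampère densities over relatively compact pieces of the carrier -/

/-- The Monge–Ampère density of a smooth weight is integrable over `reg|T| ∩ S` whenever `S` lies
in a compact subset of `Ω` (Lelong: finite mass; the density is bounded there). [folklore] -/
theorem integrableOn_twoPow_ddcForm_of_subset_compact (T : HolomorphicChain 𝓘(ℂ, V) Ω (q + 1))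
    {u : V → ℝ} (hu : ContDiff ℝ ∞ u) {Kc S : Set V} (hK : IsCompact Kc) (hKΩ : Kc ⊆ (Ω : Set V))
    (hS : S ⊆ Kc) (hSm : MeasurableSet S) :
    IntegrableOn (fun z => (ddcForm u z).twoPow (q + 1) (T.orientationFrame z)) (T.carrier ∩ S)
      (μHE[2 * (q + 1)] : Measure V) := by
  obtain ⟨C, hC⟩ := T.exists_bound_twoPow_ddcForm_orientationFrame hu hK
  have hfin : (μHE[2 * (q + 1)] : Measure V) (T.carrier ∩ S) < ⊤ :=
    (measure_mono (inter_subset_inter_right _ hS)).trans_lt (T.measure_carrier_inter_lt_top hK hKΩ)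
  refine ⟨(T.aestronglyMeasurable_twoPow_ddcForm_orientationFrame hu).mono_measure
      (Measure.restrict_mono inter_subset_left le_rfl),
    HasFiniteIntegral.restrict_of_bounded (C := C) hfin ?_⟩
  filter_upwards [ae_restrict_mem (T.measurableSet_carrier.inter hSm)] with z hz
  exact hC z (hS hz.2)

/-! ### The Monge–Ampère mass of cylindrical profile weights over a sheeted tube -/

section Cyl

variable {K : Submodule ℂ V}

/-- **The Monge–Ampère mass of a cylindrical profile weight over a `k`-sheeted tube** is
`k · (q+1)! 2^{q+1} · c(2(q+1))`: for `[T]` `k`-sheeted over `G ⊆ B(b, ε)` in `U` along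
`ℓ : V → K` (`dim K = q + 1`) with null exceptional sets, `0 < ρ₁ ≤ ε`, and a profile `h`
located left of `log ρ₁ - 1`,
`∫_{reg|T| ∩ U ∩ ℓ⁻¹ B(b,ρ₁)} (dd^c (w_h ∘ ℓ))^{q+1}(ξ_T) d𝓗 = k (q+1)! 2^{q+1} c(2(q+1))`, and the
integrand is integrable there. [cite: Chirka1989, §15.1 Prop. 2 (proof)] -/
theorem setIntegral_twoPow_ddcForm_cyl_eq (T : HolomorphicChain 𝓘(ℂ, V) Ω (q + 1))
    (hKdim : finrank ℂ K = q + 1) {ℓ : V →L[ℂ] K} {U : Set V} {G : Set K} {k : ℕ}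
    (hIS : T.IsSheetedOver ℓ U G k) {b : K} {ε : ℝ}
    (hnullK : (μHE[2 * (q + 1)] : Measure K) (ball b ε \ G) = 0)
    (hnullV : (μHE[2 * (q + 1)] : Measure V) (T.carrier ∩ U ∩ ℓ ⁻¹' (ball b ε \ G)) = 0)
    {ρ₁ : ℝ} (hρ₁ : 0 < ρ₁) (hρ₁ε : ρ₁ ≤ ε) {h : ℝ → ℝ} {s e : ℝ} (hh : IsProfileTransition h s e)
    (hs : s + e ≤ Real.log ρ₁ - 1) :
    IntegrableOn (fun z => (ddcForm (fun y => radialWeight h s e b (ℓ y)) z).twoPow (q + 1)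
        (T.orientationFrame z)) (T.carrier ∩ U ∩ ℓ ⁻¹' ball b ρ₁) (μHE[2 * (q + 1)] : Measure V) ∧
    ∫ z in T.carrier ∩ U ∩ ℓ ⁻¹' ball b ρ₁,
        (ddcForm (fun y => radialWeight h s e b (ℓ y)) z).twoPow (q + 1) (T.orientationFrame z)
        ∂(μHE[2 * (q + 1)] : Measure V) =
      k * (((q + 1).factorial : ℝ) * 2 ^ (q + 1) * (unitBallVolume (2 * (q + 1))).toReal) := by
  set g : K → ℝ := radialWeight h s e b with hg
  have hgs : ContDiff ℝ ∞ g := hh.contDiff_radialWeight b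
  have hg2 : ContDiff ℝ 2 g := hgs.of_le (by norm_cast)
  set Φ : K → K [⋀^Fin (2 * (q + 1))]→L[ℝ] ℝ := fun w => (ddcForm g w).twoPow (q + 1) with hΦ
  have hΦc : Continuous Φ := continuous_twoPow_ddcForm hgs (q + 1)
  set F : V → ℝ := fun z => (ddcForm (fun y => g (ℓ y)) z).twoPow (q + 1) (T.orientationFrame z) with hF
  -- the integrand is the pulled-back form evaluated on the orientation
  have hFΦ : ∀ z, F z = Φ (ℓ z) (fun i => ℓ (T.orientationFrame z i)) := fun z =>
    twoPow_ddcForm_comp_clm_apply ℓ hg2 z (q + 1) _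
  -- non-negativity on the carrier
  have hF0 : ∀ z ∈ T.carrier, 0 ≤ F z := fun z hz =>
    T.twoPow_ddcForm_orientationFrame_nonneg
      (((hh.contDiff_radialWeight_comp ℓ b).of_le (by norm_cast)).contDiffAt)
      (fun v => hh.levi_radialWeight_comp_nonneg ℓ b z v) hz
  -- the base integrand and its value
  set e₀ : OrthonormalBasis (Fin (q + 1)) ℂ K := (stdOrthonormalBasis ℂ K).reindex
    (finCongr (by rw [hKdim])) with he₀
  have hbase0 : ∀ w, 0 ≤ Φ w (complexFrame e₀) := fun w => by
    rw [hΦ]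
    simp only
    rw [← apply_orientationFrame_plane_top_eq hKdim _ e₀.orthonormal w]
    exact (plane (⊤ : Submodule ℂ K) (finrank_top_eq hKdim)).twoPow_ddcForm_orientationFrame_nonneg
      (hg2.contDiffAt) (fun v => hh.levi_radialWeight_nonneg b w v)
      (by rw [carrier_plane_top hKdim]; trivial)
  have hbase := integral_ball_twoPow_ddcForm_radialWeight hKdim b hρ₁ hh hs e₀.orthonormal
  -- the projection formula, over `S = B(b, ρ₁)` split along `G`
  set S : Set K := ball b ρ₁ with hSdef
  have hSm : MeasurableSet S := measurableSet_ball
  have hSε : S ⊆ ball b ε := ball_subset_ball hρ₁ε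
  have hproj : ∫⁻ z in T.carrier ∩ U ∩ ℓ ⁻¹' S, ENNReal.ofReal (F z) ∂(μHE[2 * (q + 1)] : Measure V) =
      k * ∫⁻ w in S, ENNReal.ofReal (Φ w (complexFrame e₀)) ∂(μHE[2 * (q + 1)] : Measure K) := by
    simp_rw [hFΦ]
    have hsplitV : T.carrier ∩ U ∩ ℓ ⁻¹' S =
        (T.carrier ∩ U ∩ ℓ ⁻¹' (S ∩ G)) ∪ (T.carrier ∩ U ∩ ℓ ⁻¹' (S \ G)) := by
      rw [← inter_union_distrib_left, ← preimage_union, inter_union_sdiff]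
    have hsplitK : (S ∩ G) ∪ (S \ G) = S := inter_union_sdiff S G
    have hnV : (μHE[2 * (q + 1)] : Measure V) (T.carrier ∩ U ∩ ℓ ⁻¹' (S \ G)) = 0 :=
      measure_mono_null (inter_subset_inter_right _ (preimage_mono (sdiff_subset_sdiff_left hSε))) hnullV
    have hnK : (μHE[2 * (q + 1)] : Measure K) (S \ G) = 0 :=
      measure_mono_null (sdiff_subset_sdiff_left hSε) hnullK
    rw [hsplitV, setLIntegral_congr (union_ae_eq_left_of_ae_eq_empty (ae_eq_empty.2 hnV)),
      hIS.lintegral_inter_preimage_eq hKdim hΦc e₀ (hSm.inter hIS.isOpen_base.measurableSet)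
        inter_subset_right, ← hsplitK,
      setLIntegral_congr (union_ae_eq_left_of_ae_eq_empty (ae_eq_empty.2 hnK)), hsplitK]
  -- the base lintegral as an integral
  have hfinK : (μHE[2 * (q + 1)] : Measure K) S < ⊤ := by
    have := measure_carrier_ofSet_inter_closedBall_lt_top (hasPureDim_planeSet (⊤ : Submodule ℂ K)
      (finrank_top_eq hKdim)) (a := b) (ρ := ρ₁) (fun _ _ => trivial)
    rw [show ofSet (planeSet (⊤ : Submodule ℂ K)) (hasPureDim_planeSet ⊤ (finrank_top_eq hKdim)) =
      plane (⊤ : Submodule ℂ K) (finrank_top_eq hKdim) from rfl, carrier_plane_top hKdim, univ_inter] at this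
    exact (measure_mono ball_subset_closedBall).trans_lt this
  have hΦe : Continuous fun w => Φ w (complexFrame e₀) := (continuous_eval_const _).comp hΦc
  have hintK : IntegrableOn (fun w => Φ w (complexFrame e₀)) S (μHE[2 * (q + 1)] : Measure K) := by
    obtain ⟨C, hC⟩ := (isCompact_closedBall b ρ₁).exists_bound_of_continuousOn hΦe.continuousOn
    refine Measure.integrableOn_of_bounded hfinK.ne hΦe.aestronglyMeasurable ?_ (M := C)
    filter_upwards [ae_restrict_mem hSm] with w hw
    exact hC w (ball_subset_closedBall hw)
  have hbaseL : ∫⁻ w in S, ENNReal.ofReal (Φ w (complexFrame e₀)) ∂(μHE[2 * (q + 1)] : Measure K) =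
      ENNReal.ofReal (((q + 1).factorial : ℝ) * 2 ^ (q + 1) * (unitBallVolume (2 * (q + 1))).toReal) := by
    rw [← ofReal_integral_eq_lintegral_ofReal hintK (ae_of_all _ hbase0), ← hbase]
  have hprojF : ∫⁻ z in T.carrier ∩ U ∩ ℓ ⁻¹' S, ENNReal.ofReal (F z) ∂(μHE[2 * (q + 1)] : Measure V) =
      ENNReal.ofReal (k * (((q + 1).factorial : ℝ) * 2 ^ (q + 1) * (unitBallVolume (2 * (q + 1))).toReal)) := by
    rw [hproj, hbaseL, ENNReal.ofReal_mul (Nat.cast_nonneg k), ENNReal.ofReal_natCast]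
  -- integrability and the value of the integral
  have hRm : MeasurableSet (T.carrier ∩ U ∩ ℓ ⁻¹' S) :=
    (T.measurableSet_carrier.inter hIS.isOpen_inner.measurableSet).inter (hSm.preimage ℓ.continuous.measurable)
  have hFm : AEStronglyMeasurable F ((μHE[2 * (q + 1)] : Measure V).restrict (T.carrier ∩ U ∩ ℓ ⁻¹' S)) :=
    (T.aestronglyMeasurable_twoPow_ddcForm_orientationFrame (hh.contDiff_radialWeight_comp ℓ b)).mono_measure
      (Measure.restrict_mono (inter_subset_left.trans inter_subset_left) le_rfl)
  have hF0ae : 0 ≤ᵐ[((μHE[2 * (q + 1)] : Measure V).restrict (T.carrier ∩ U ∩ ℓ ⁻¹' S))] F := by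
    filter_upwards [ae_restrict_mem hRm] with z hz
    exact hF0 z hz.1.1
  have hint : IntegrableOn F (T.carrier ∩ U ∩ ℓ ⁻¹' S) (μHE[2 * (q + 1)] : Measure V) := by
    refine ⟨hFm, ?_⟩
    rw [hasFiniteIntegral_iff_ofReal hF0ae, hprojF]
    exact ENNReal.ofReal_lt_top
  refine ⟨hint, ?_⟩
  rw [integral_eq_lintegral_of_nonneg_ae hF0ae hFm, hprojF, ENNReal.toReal_ofReal]
  positivity

end Cyl

/-! ### The inequality `Λ ≤ l'ᵖ k c(2p)` -/

section Upper

variable {K : Submodule ℂ V}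

set_option maxHeartbeats 1000000 in
/-- **`n(A, a) ≤ l'ᵖ μ_a`**: with the cone condition on the tube `U ∋ a`, properness over the
base, the cylinder masses `k (q+1)! 2^{q+1} c` and the radial mass identity of
`exists_lelong_data`, the Lelong limit satisfies `Λ ≤ l'^{q+1} k c(2(q+1))` for every `l' > 1`
(comparison with `u = m₁(w₁, l' ŵ₂ - c')`, `w₁` radial at scale `ρ₂`, `ŵ₂` cylindrical at scale
`ρ₂`, over the tube piece `U ∩ ℓ⁻¹ B(ℓ a, ρ₁)`, `ρ₂ = ρ₁ e^{-X}` with `(l' - 1) X` large).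
[cite: Chirka1989, §15.1 Prop. 2] -/
theorem lelong_le_mul_sheets {A : Set Ω} (hA : HasPureDim 𝓘(ℂ, V) A (q + 1)) {a : V} {U : Set V}
    (haU : a ∈ U) (hUo : IsOpen U) (hUΩ : U ⊆ (Ω : Set V)) (ℓ : V →L[ℂ] K) {C₀ : ℝ} (hC₀ : 1 ≤ C₀)
    (hcone : ∀ z ∈ (ofSet A hA).carrier ∩ U, ‖z - a‖ ≤ C₀ * ‖ℓ z - ℓ a‖) {ε₀ : ℝ} (hε₀ : 0 < ε₀)
    (hproper : ∀ ρ', 0 < ρ' → ρ' < ε₀ → ∃ Kc : Set V, IsCompact Kc ∧ Kc ⊆ U ∧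
      (ofSet A hA).carrier ∩ U ∩ ℓ ⁻¹' closedBall (ℓ a) ρ' ⊆ Kc)
    {k : ℕ} (hcyl : ∀ ρ₁, 0 < ρ₁ → ρ₁ < ε₀ → ∀ (h : ℝ → ℝ) (s e : ℝ), IsProfileTransition h s e →
      s + e ≤ Real.log ρ₁ - 1 →
      IntegrableOn (fun z => (ddcForm (fun y => radialWeight h s e (ℓ a) (ℓ y)) z).twoPow (q + 1)
        ((ofSet A hA).orientationFrame z)) ((ofSet A hA).carrier ∩ U ∩ ℓ ⁻¹' ball (ℓ a) ρ₁)
        (μHE[2 * (q + 1)] : Measure V) ∧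
      ∫ z in (ofSet A hA).carrier ∩ U ∩ ℓ ⁻¹' ball (ℓ a) ρ₁,
        (ddcForm (fun y => radialWeight h s e (ℓ a) (ℓ y)) z).twoPow (q + 1) ((ofSet A hA).orientationFrame z)
        ∂(μHE[2 * (q + 1)] : Measure V) =
      k * (((q + 1).factorial : ℝ) * 2 ^ (q + 1) * (unitBallVolume (2 * (q + 1))).toReal))
    {ρ : ℝ} (hρ : 0 < ρ) {Λ : ℝ≥0∞}
    (hdata : ∀ ρ' ∈ Ioc 0 ρ, ∀ (h : ℝ → ℝ) (s e : ℝ), IsProfileTransition h s e → s + e ≤ Real.log ρ' - 1 →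
      ENNReal.ofReal ((((q + 1).factorial : ℝ) * 2 ^ (q + 1))⁻¹ *
        ∫ z in (ofSet A hA).carrier ∩ ball a ρ',
          (ddcForm (radialWeight h s e a) z).twoPow (q + 1) ((ofSet A hA).orientationFrame z)
          ∂(μHE[2 * (q + 1)] : Measure V)) = (ofSet A hA).lelongW a ρ' + Λ)
    {l' : ℝ} (hl' : 1 < l') :
    Λ ≤ ENNReal.ofReal (l' ^ (q + 1) * k * (unitBallVolume (2 * (q + 1))).toReal) := by
  set T := ofSet A hA with hT
  set b : K := ℓ a with hb
  set cq : ℝ := ((q + 1).factorial : ℝ) * 2 ^ (q + 1) with hcq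
  set cK : ℝ := (unitBallVolume (2 * (q + 1))).toReal with hcK
  have hcq_pos : 0 < cq := by positivity
  have hl'0 : 0 < l' := by linarith
  have hl'1 : 0 < l' - 1 := by linarith
  have hC₀pos : 0 < C₀ := by linarith
  -- constants (kept opaque)
  obtain ⟨Cℓ, hCℓ⟩ : ∃ C : ℝ, C = max ‖ℓ‖ 1 := ⟨_, rfl⟩
  have hCℓ1 : 1 ≤ Cℓ := by rw [hCℓ]; exact le_max_right _ _
  have hCℓpos : 0 < Cℓ := by linarith
  have hℓle : ‖ℓ‖ ≤ Cℓ := by rw [hCℓ]; exact le_max_left _ _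
  obtain ⟨δU, hδU, hballU⟩ := Metric.isOpen_iff.1 hUo a haU
  obtain ⟨ρ₁, hρ₁⟩ : ∃ r : ℝ, r = min (ε₀ / 2) (min ρ δU) := ⟨_, rfl⟩
  have hρ₁pos : 0 < ρ₁ := by rw [hρ₁]; positivity
  have hρ₁ε : ρ₁ < ε₀ := by rw [hρ₁]; exact (min_le_left _ _).trans_lt (by linarith)
  have hρ₁ρ : ρ₁ ≤ ρ := by rw [hρ₁]; exact (min_le_right _ _).trans (min_le_left _ _)
  have hρ₁δ : ρ₁ ≤ δU := by rw [hρ₁]; exact (min_le_right _ _).trans (min_le_right _ _)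
  have hlog3C : 0 ≤ Real.log (3 * Cℓ) := Real.log_nonneg (by linarith)
  have hlogC : 0 ≤ Real.log Cℓ := Real.log_nonneg hCℓ1
  have hlogC₀ : 0 ≤ Real.log C₀ := Real.log_nonneg hC₀
  obtain ⟨B, hB⟩ : ∃ x : ℝ, x = l' * Real.log (3 * Cℓ) + 2 * l' + Real.log C₀ + 6 := ⟨_, rfl⟩
  have hlB : l' * Real.log (3 * Cℓ) ≥ 0 := by positivity
  have hB0 : 0 ≤ B := by rw [hB]; positivity
  obtain ⟨X, hX⟩ : ∃ x : ℝ, x = B / (l' - 1) + 1 := ⟨_, rfl⟩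
  have hXB : l' * X = X + B + (l' - 1) := by
    have : (l' - 1) * X = B + (l' - 1) := by rw [hX]; field_simp
    linarith
  have hXlog : Real.log (3 * Cℓ) + 1 ≤ X := by
    have h1 : (l' - 1) * Real.log (3 * Cℓ) ≤ l' * Real.log (3 * Cℓ) :=
      mul_le_mul_of_nonneg_right (by linarith) hlog3C
    have h2 : Real.log (3 * Cℓ) ≤ B / (l' - 1) := by
      rw [le_div_iff₀ hl'1, hB]; linarith
    rw [hX]; linarith
  have hXpos : 0 < X := by linarith
  obtain ⟨ρ₂, hρ₂⟩ : ∃ r : ℝ, r = ρ₁ * Real.exp (-X) := ⟨_, rfl⟩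
  have hρ₂pos : 0 < ρ₂ := by rw [hρ₂]; exact mul_pos hρ₁pos (Real.exp_pos _)
  have hexp_le : Real.exp (-X) ≤ (3 * Cℓ * Real.exp 1)⁻¹ := by
    rw [← Real.exp_log (by positivity : 0 < 3 * Cℓ * Real.exp 1), ← Real.exp_neg, Real.exp_le_exp,
      Real.log_mul (by positivity) (Real.exp_pos 1).ne', Real.log_exp]
    linarith
  have hCρ₂ : Cℓ * ρ₂ < ρ₁ := by
    have he : (2 : ℝ) ≤ Real.exp 1 := by linarith [Real.add_one_le_exp (1 : ℝ)]
    have h1 : Cℓ * ρ₂ ≤ ρ₁ * (3 * Real.exp 1)⁻¹ := by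
      rw [hρ₂]
      calc Cℓ * (ρ₁ * Real.exp (-X)) ≤ Cℓ * (ρ₁ * (3 * Cℓ * Real.exp 1)⁻¹) := by gcongr
        _ = ρ₁ * (3 * Real.exp 1)⁻¹ := by field_simp
    have h2 : ρ₁ * (3 * Real.exp 1)⁻¹ < ρ₁ := by
      rw [← div_eq_mul_inv]; exact div_lt_self hρ₁pos (by linarith)
    linarith
  have hρ₂ρ₁ : ρ₂ < ρ₁ := (le_mul_of_one_le_left hρ₂pos.le hCℓ1).trans_lt hCρ₂
  have hρ₂ρ : ρ₂ ≤ ρ := hρ₂ρ₁.le.trans hρ₁ρ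
  have hlogρ₂ : Real.log ρ₂ = Real.log ρ₁ - X := by
    rw [hρ₂, Real.log_mul hρ₁pos.ne' (Real.exp_pos _).ne', Real.log_exp]; ring
  -- profiles at scale `ρ₂`
  obtain ⟨s₀, hs₀⟩ : ∃ x : ℝ, x = Real.log ρ₂ - 2 := ⟨_, rfl⟩
  have hs₀ρ₂ : s₀ + 1 ≤ Real.log ρ₂ - 1 := by rw [hs₀]; linarith
  have hs₀ρ₁ : s₀ + 1 ≤ Real.log ρ₁ - 1 := by
    have := Real.log_le_log hρ₂pos hρ₂ρ₁.le; rw [hs₀]; linarith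
  obtain ⟨h₁, hh₁⟩ := exists_isProfileTransition s₀ one_pos
  -- the weights (kept opaque)
  obtain ⟨c', hc'⟩ : ∃ x : ℝ, x = l' * (Real.log Cℓ + 3) + 2 := ⟨_, rfl⟩
  have hlC3 : 0 ≤ l' * (Real.log Cℓ + 3) := by positivity
  obtain ⟨w₁, hw₁⟩ : ∃ f : V → ℝ, f = radialWeight h₁ s₀ 1 a := ⟨_, rfl⟩
  obtain ⟨w₂, hw₂⟩ : ∃ f : V → ℝ, f = fun y => radialWeight h₁ s₀ 1 b (ℓ y) := ⟨_, rfl⟩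
  obtain ⟨A₁, hA₁⟩ : ∃ f : V → ℝ, f = fun y => 1 * radialWeight h₁ s₀ 1 a y + 0 := ⟨_, rfl⟩
  obtain ⟨Lo, hLo⟩ : ∃ f : V → ℝ, f = fun y => l' * radialWeight h₁ s₀ 1 b (ℓ y) + -c' := ⟨_, rfl⟩
  obtain ⟨u, hu⟩ : ∃ f : V → ℝ, f = fun y => smoothMax 1 (A₁ y) (Lo y) := ⟨_, rfl⟩
  have hA₁w₁ : A₁ = w₁ := by rw [hA₁, hw₁]; funext y; ring
  have hLow₂ : ∀ y, Lo y = l' * w₂ y + -c' := fun y => by rw [hLo, hw₂]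
  have hw₁s : ContDiff ℝ ∞ w₁ := by rw [hw₁]; exact hh₁.contDiff_radialWeight a
  have hw₂s : ContDiff ℝ ∞ w₂ := by rw [hw₂]; exact hh₁.contDiff_radialWeight_comp ℓ b
  have hA₁s : ContDiff ℝ ∞ A₁ := by rw [hA₁w₁]; exact hw₁s
  have hLos : ContDiff ℝ ∞ Lo := by
    rw [show Lo = fun y => l' * w₂ y + -c' from funext hLow₂]
    exact (contDiff_const.mul hw₂s).add contDiff_const
  have hus : ContDiff ℝ ∞ u := by rw [hu]; exact (contDiff_smoothMax (η := 1)).comp (hA₁s.prodMk hLos)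
  -- value bounds
  have hlog_norm_sq : ∀ x : ℝ, Real.log (x ^ 2) / 2 = Real.log x := fun x => by
    rw [Real.log_pow]; push_cast; ring
  have hw₁0 : ∀ z, 0 ≤ w₁ z := fun z => by rw [hw₁]; exact hh₁.profileWeight_nonneg _
  have hw₁le : ∀ z, w₁ z ≤ max 0 (Real.log ‖z - a‖ - s₀ - 1) + 2 := fun z => by
    have := hh₁.profileWeight_le (‖z - a‖ ^ 2)
    rw [hlog_norm_sq] at this
    rw [hw₁, radialWeight]; linarith
  have hw₂le : ∀ z, w₂ z ≤ max 0 (Real.log ‖ℓ z - b‖ - s₀ - 1) + 2 := fun z => by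
    have := hh₁.profileWeight_le (‖ℓ z - b‖ ^ 2)
    rw [hlog_norm_sq] at this
    rw [hw₂]; simp only [radialWeight]; linarith
  have hw₂ge : ∀ z, ℓ z ≠ b → Real.log ‖ℓ z - b‖ - s₀ - 1 ≤ w₂ z := fun z hz => by
    have hpos : 0 < ‖ℓ z - b‖ ^ 2 := pow_pos (norm_pos_iff.2 (sub_ne_zero.2 hz)) 2
    have := hh₁.profileWeight_ge hpos
    rw [hlog_norm_sq] at this
    rw [hw₂]; simp only [radialWeight]; linarith
  have hℓza : ∀ z, ‖ℓ z - b‖ ≤ Cℓ * ‖z - a‖ := fun z => by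
    rw [hb, ← map_sub]
    exact (ℓ.le_opNorm _).trans (mul_le_mul_of_nonneg_right hℓle (norm_nonneg _))
  have hw₁a : ∀ z, z = a → w₁ z = 0 := fun z hz => by
    rw [hw₁, radialWeight, hz, sub_self, norm_zero, zero_pow two_ne_zero]
    exact IsProfileTransition.profileWeight_of_nonpos le_rfl
  have hw₂b : ∀ z, ℓ z = b → w₂ z = 0 := fun z hz => by
    rw [hw₂]
    simp only [radialWeight]
    rw [hz, sub_self, norm_zero, zero_pow two_ne_zero]
    exact IsProfileTransition.profileWeight_of_nonpos le_rfl
  -- (h2): on `B(a, ρ₂)`, `Lo ≤ -2`, hence `Lo + 1 < A₁`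
  have hLo_ball : ∀ z ∈ ball a ρ₂, Lo z ≤ -2 := by
    intro z hz
    rw [mem_ball, dist_eq_norm] at hz
    rw [hLow₂]
    by_cases hzb : ℓ z = b
    · rw [hw₂b z hzb, mul_zero, zero_add, hc']; linarith
    · have h1 : Real.log ‖ℓ z - b‖ ≤ Real.log Cℓ + Real.log ρ₂ := by
        rw [← Real.log_mul hCℓpos.ne' hρ₂pos.ne']
        exact Real.log_le_log (norm_pos_iff.2 (sub_ne_zero.2 hzb))
          ((hℓza z).trans (mul_le_mul_of_nonneg_left hz.le hCℓpos.le))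
      have hmax : max 0 (Real.log ‖ℓ z - b‖ - s₀ - 1) ≤ Real.log Cℓ + 1 :=
        max_le (by linarith) (by rw [hs₀]; linarith)
      have h2 : w₂ z ≤ Real.log Cℓ + 3 := (hw₂le z).trans (by linarith)
      have h3 : l' * w₂ z ≤ l' * (Real.log Cℓ + 3) := mul_le_mul_of_nonneg_left h2 hl'0.le
      rw [hc']; linarith
  have hin_lt : ∀ z ∈ ball a ρ₂, Lo z + 1 < A₁ z := fun z hz => by
    have := hLo_ball z hz; rw [hA₁w₁]; linarith [hw₁0 z]
  -- (h3): at carrier points of the tube with `ρ₁/3 < ‖ℓ z - b‖ < ρ₁`, `A₁ + 1 < Lo`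
  have hout_lt : ∀ z ∈ T.carrier ∩ U, ρ₁ / 3 < ‖ℓ z - b‖ → ‖ℓ z - b‖ < ρ₁ → A₁ z + 1 < Lo z := by
    rintro z hz hzlo hzhi
    have hza : ‖z - a‖ ≤ C₀ * ρ₁ := (hcone z hz).trans (mul_le_mul_of_nonneg_left hzhi.le hC₀pos.le)
    have hposX : 0 ≤ Real.log C₀ + X + 3 := by positivity
    have hIn_le : A₁ z ≤ Real.log C₀ + X + 3 := by
      rw [hA₁w₁]
      by_cases hza0 : z = a
      · rw [hw₁a z hza0]; exact hposX
      · refine (hw₁le z).trans ?_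
        have h1 : Real.log ‖z - a‖ ≤ Real.log C₀ + Real.log ρ₁ := by
          rw [← Real.log_mul hC₀pos.ne' hρ₁pos.ne']
          exact Real.log_le_log (norm_pos_iff.2 (sub_ne_zero.2 hza0)) hza
        have hmax : max 0 (Real.log ‖z - a‖ - s₀ - 1) ≤ Real.log C₀ + X + 1 :=
          max_le (by positivity) (by rw [hs₀, hlogρ₂]; linarith)
        linarith
    have hzb : ℓ z ≠ b := fun h => by
      rw [h, sub_self, norm_zero] at hzlo; linarith
    have hLo_ge : l' * X - l' * Real.log (3 * Cℓ) - 2 * l' - 2 ≤ Lo z := by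
      have h1 : Real.log (ρ₁ / 3) ≤ Real.log ‖ℓ z - b‖ := Real.log_le_log (by positivity) hzlo.le
      rw [Real.log_div hρ₁pos.ne' (by norm_num)] at h1
      have h2 : Real.log ρ₁ - Real.log 3 - s₀ - 1 ≤ w₂ z := by linarith [hw₂ge z hzb]
      rw [hs₀, hlogρ₂] at h2
      have h3 : X - Real.log 3 + 1 ≤ w₂ z := by linarith
      have h4 : l' * (X - Real.log 3 + 1) ≤ l' * w₂ z := mul_le_mul_of_nonneg_left h3 hl'0.le
      rw [hLow₂, hc', Real.log_mul (by norm_num) hCℓpos.ne']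
      nlinarith [h4]
    rw [hB] at hXB
    linarith
  -- the sets
  obtain ⟨U', hU'⟩ : ∃ W : Set V, W = U ∩ ℓ ⁻¹' ball b ρ₁ := ⟨_, rfl⟩
  have hU'o : IsOpen U' := by rw [hU']; exact hUo.inter (isOpen_ball.preimage ℓ.continuous)
  have hU'U : U' ⊆ U := by rw [hU']; exact inter_subset_left
  have hU'Ω : U' ⊆ (Ω : Set V) := hU'U.trans hUΩ
  have hU'mem : ∀ {z}, z ∈ U' ↔ z ∈ U ∧ ‖ℓ z - b‖ < ρ₁ := fun {z} => by
    rw [hU']; simp [dist_eq_norm]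
  obtain ⟨Kc, hKc, hKcU, hKsub⟩ := hproper (ρ₁ / 3) (by positivity) (by linarith)
  obtain ⟨Kz, hKz⟩ : ∃ W : Set V, W = Kc ∩ ℓ ⁻¹' closedBall b (ρ₁ / 3) := ⟨_, rfl⟩
  have hKzc : IsCompact Kz := by rw [hKz]; exact hKc.inter_right (isClosed_closedBall.preimage ℓ.continuous)
  have hKzmem : ∀ {z}, z ∈ Kz ↔ z ∈ Kc ∧ ‖ℓ z - b‖ ≤ ρ₁ / 3 := fun {z} => by
    rw [hKz]; simp [dist_eq_norm]
  have hKzU' : Kz ⊆ U' := fun z hz => by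
    rw [hKzmem] at hz; rw [hU'mem]; exact ⟨hKcU hz.1, by linarith [hz.2]⟩
  have hSU' : ball a ρ₂ ⊆ U' := fun z hz => by
    rw [hU'mem]
    refine ⟨hballU (ball_subset_ball (hρ₂ρ₁.le.trans hρ₁δ) hz), ?_⟩
    rw [mem_ball, dist_eq_norm] at hz
    calc ‖ℓ z - b‖ ≤ Cℓ * ‖z - a‖ := hℓza z
      _ ≤ Cℓ * ρ₂ := mul_le_mul_of_nonneg_left hz.le hCℓpos.le
      _ < ρ₁ := hCρ₂
  -- integrability over `reg A ∩ U'` (inside a compact subset of `U`)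
  obtain ⟨Kc₁, hKc₁, hKc₁U, hK₁sub⟩ := hproper ρ₁ hρ₁pos hρ₁ε
  have hcarU' : T.carrier ∩ U' = T.carrier ∩ (U' ∩ Kc₁) := by
    apply Subset.antisymm _ (inter_subset_inter_right _ inter_subset_left)
    rintro z ⟨hzc, hzU'⟩
    have hz' := hU'mem.1 hzU'
    exact ⟨hzc, hzU', hK₁sub ⟨⟨hzc, hz'.1⟩, by
      show ℓ z ∈ closedBall b ρ₁; rw [mem_closedBall, dist_eq_norm]; exact hz'.2.le⟩⟩
  have hintU' : ∀ {w : V → ℝ}, ContDiff ℝ ∞ w →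
      IntegrableOn (fun z => (ddcForm w z).twoPow (q + 1) (T.orientationFrame z)) (T.carrier ∩ U')
        (μHE[2 * (q + 1)] : Measure V) := fun hw => by
    rw [hcarU']
    exact T.integrableOn_twoPow_ddcForm_of_subset_compact hw hKc₁ (hKc₁U.trans hUΩ) inter_subset_right
      (hU'o.measurableSet.inter hKc₁.isClosed.measurableSet)
  -- the comparison inequality
  have hpsh : ∀ z ∈ T.carrier, 0 ≤ (ddcForm u z).twoPow (q + 1) (T.orientationFrame z) := by
    intro z hz
    rw [hu, hA₁, hLo]
    exact T.twoPow_ddcForm_smoothMax_nonneg hh₁ hh₁ a ℓ b zero_le_one hl'0.le 0 (-c') one_pos hz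
  have hcomp := setIntegral_twoPow_ddcForm_le_of_comparison hA (u := u) (φi := w₁) (φo := Lo) hus hLos
    hU'o hU'Ω hKzc hKzU' hSU' measurableSet_ball hpsh
    (fun z hz => by
      have h := smoothMax_eventuallyEq_left one_pos hA₁s.continuous hLos.continuous (hin_lt z hz.2)
      rw [← hu, hA₁w₁] at h; exact h)
    (fun z hz hzK => by
      have hz' := hU'mem.1 hz.2
      have hlo : ρ₁ / 3 < ‖ℓ z - b‖ := by
        by_contra hle
        rw [not_lt] at hle
        refine hzK (hKzmem.2 ⟨hKsub ⟨⟨hz.1, hz'.1⟩, ?_⟩, hle⟩)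
        show ℓ z ∈ closedBall b (ρ₁ / 3); rw [mem_closedBall, dist_eq_norm]; exact hle
      have h := smoothMax_eventuallyEq_right one_pos hA₁s.continuous hLos.continuous
        (hout_lt z ⟨hz.1, hz'.1⟩ hlo hz'.2)
      rw [← hu] at h; exact h)
    (hintU' hus) (hintU' hLos)
  -- evaluate the right-hand side: `l'^{q+1} · k cq cK`
  obtain ⟨-, hcylv⟩ := hcyl ρ₁ hρ₁pos hρ₁ε h₁ s₀ 1 hh₁ hs₀ρ₁
  have hRHS : ∫ z in T.carrier ∩ U', (ddcForm Lo z).twoPow (q + 1) (T.orientationFrame z)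
      ∂(μHE[2 * (q + 1)] : Measure V) = l' ^ (q + 1) * (k * (cq * cK)) := by
    rw [← hcylv, hU', show (fun z => (ddcForm Lo z).twoPow (q + 1) (T.orientationFrame z)) =
        fun z => l' ^ (q + 1) * (ddcForm (fun y => radialWeight h₁ s₀ 1 b (ℓ y)) z).twoPow (q + 1)
          (T.orientationFrame z) from funext fun z => by
      rw [hLo]
      exact twoPow_ddcForm_const_mul_add_const_apply
        ((hh₁.contDiff_radialWeight_comp ℓ b).of_le (by norm_cast)) l' (-c') z (q + 1) _]
    rw [← inter_assoc]
    exact integral_const_mul (l' ^ (q + 1)) _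
  -- evaluate the left-hand side through `exists_lelong_data`
  have hLHS := hdata ρ₂ ⟨hρ₂pos, hρ₂ρ⟩ h₁ s₀ 1 hh₁ hs₀ρ₂
  rw [← hw₁] at hLHS
  have hle : ENNReal.ofReal (cq⁻¹ * ∫ z in T.carrier ∩ ball a ρ₂, (ddcForm w₁ z).twoPow (q + 1)
      (T.orientationFrame z) ∂(μHE[2 * (q + 1)] : Measure V)) ≤
      ENNReal.ofReal (l' ^ (q + 1) * k * cK) := by
    refine ENNReal.ofReal_le_ofReal ?_
    calc cq⁻¹ * ∫ z in T.carrier ∩ ball a ρ₂, (ddcForm w₁ z).twoPow (q + 1) (T.orientationFrame z)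
          ∂(μHE[2 * (q + 1)] : Measure V)
        ≤ cq⁻¹ * (l' ^ (q + 1) * (k * (cq * cK))) := by
          rw [← hRHS]; exact mul_le_mul_of_nonneg_left hcomp (inv_nonneg.2 hcq_pos.le)
      _ = l' ^ (q + 1) * k * cK := by field_simp
  calc Λ ≤ T.lelongW a ρ₂ + Λ := le_add_self
    _ = _ := hLHS.symm
    _ ≤ _ := hle

end Upper

/-! ### The inequality `k c(2p) ≤ l'ᵖ (W(ρ) + Λ)` -/

section Lower

variable {K : Submodule ℂ V}

set_option maxHeartbeats 1000000 in
/-- **`μ_a ≤ l'ᵖ (W(ρ) + n(A, a))`**: with the cone condition on the tube `U ∋ a`, the cylinder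
masses `k (q+1)! 2^{q+1} c` and the radial mass identity on `B(a, ρ) ⊆ U` (`𝐁(a, ρ) ⊆ Ω`,
`ρ ≤ ε₀`), `k c(2(q+1)) ≤ l'^{q+1} (W(ρ) + Λ)` for every `l' > 1` (comparison with
`u = m₁(l' w₁ - c', ŵ₂)` over the ball `B(a, ρ)`, `w₁` radial and `ŵ₂` cylindrical at scale
`ρ₁ = ρ e^{-X}` with `(l' - 1) X` large; the carrier over the base ball `B(ℓ a, ρ₁)` lies in
`B(a, ρ/3)` by the cone condition). [cite: Chirka1989, §15.1 Prop. 2] -/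
theorem sheets_le_mul_lelong {A : Set Ω} (hA : HasPureDim 𝓘(ℂ, V) A (q + 1)) {a : V} {U : Set V}
    (hUo : IsOpen U) (ℓ : V →L[ℂ] K) {C₀ : ℝ} (hC₀ : 1 ≤ C₀)
    (hcone : ∀ z ∈ (ofSet A hA).carrier ∩ U, ‖z - a‖ ≤ C₀ * ‖ℓ z - ℓ a‖) {ε₀ : ℝ}
    {k : ℕ} (hcyl : ∀ ρ₁, 0 < ρ₁ → ρ₁ < ε₀ → ∀ (h : ℝ → ℝ) (s e : ℝ), IsProfileTransition h s e →
      s + e ≤ Real.log ρ₁ - 1 →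
      IntegrableOn (fun z => (ddcForm (fun y => radialWeight h s e (ℓ a) (ℓ y)) z).twoPow (q + 1)
        ((ofSet A hA).orientationFrame z)) ((ofSet A hA).carrier ∩ U ∩ ℓ ⁻¹' ball (ℓ a) ρ₁)
        (μHE[2 * (q + 1)] : Measure V) ∧
      ∫ z in (ofSet A hA).carrier ∩ U ∩ ℓ ⁻¹' ball (ℓ a) ρ₁,
        (ddcForm (fun y => radialWeight h s e (ℓ a) (ℓ y)) z).twoPow (q + 1) ((ofSet A hA).orientationFrame z)
        ∂(μHE[2 * (q + 1)] : Measure V) =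
      k * (((q + 1).factorial : ℝ) * 2 ^ (q + 1) * (unitBallVolume (2 * (q + 1))).toReal))
    {ρ : ℝ} (hρ : 0 < ρ) (hρε : ρ < ε₀) (hρΩ : closedBall a ρ ⊆ (Ω : Set V))
    {Λ : ℝ≥0∞}
    (hdata : ∀ (h : ℝ → ℝ) (s e : ℝ), IsProfileTransition h s e → s + e ≤ Real.log ρ - 1 →
      ENNReal.ofReal ((((q + 1).factorial : ℝ) * 2 ^ (q + 1))⁻¹ *
        ∫ z in (ofSet A hA).carrier ∩ ball a ρ,
          (ddcForm (radialWeight h s e a) z).twoPow (q + 1) ((ofSet A hA).orientationFrame z)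
          ∂(μHE[2 * (q + 1)] : Measure V)) = (ofSet A hA).lelongW a ρ + Λ)
    {l' : ℝ} (hl' : 1 < l') :
    ENNReal.ofReal (k * (unitBallVolume (2 * (q + 1))).toReal) ≤
      ENNReal.ofReal (l' ^ (q + 1)) * ((ofSet A hA).lelongW a ρ + Λ) := by
  set T := ofSet A hA with hT
  set b : K := ℓ a with hb
  set cq : ℝ := ((q + 1).factorial : ℝ) * 2 ^ (q + 1) with hcq
  set cK : ℝ := (unitBallVolume (2 * (q + 1))).toReal with hcK
  have hcq_pos : 0 < cq := by positivity
  have hcK0 : 0 ≤ cK := ENNReal.toReal_nonneg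
  have hl'0 : 0 < l' := by linarith
  have hl'1 : 0 < l' - 1 := by linarith
  have hC₀pos : 0 < C₀ := by linarith
  have hUΩ' : ball a ρ ⊆ (Ω : Set V) := ball_subset_closedBall.trans hρΩ
  -- constants (kept opaque)
  obtain ⟨Cℓ, hCℓ⟩ : ∃ C : ℝ, C = max ‖ℓ‖ 1 := ⟨_, rfl⟩
  have hCℓ1 : 1 ≤ Cℓ := by rw [hCℓ]; exact le_max_right _ _
  have hCℓpos : 0 < Cℓ := by linarith
  have hℓle : ‖ℓ‖ ≤ Cℓ := by rw [hCℓ]; exact le_max_left _ _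
  have hlog3C₀ : 0 ≤ Real.log (3 * C₀) := Real.log_nonneg (by linarith)
  have hlogC : 0 ≤ Real.log Cℓ := Real.log_nonneg hCℓ1
  have hlogC₀ : 0 ≤ Real.log C₀ := Real.log_nonneg hC₀
  obtain ⟨B, hB⟩ : ∃ x : ℝ, x = l' * Real.log (3 * C₀) + 2 * l' + Real.log Cℓ + 6 := ⟨_, rfl⟩
  have hlB : l' * Real.log (3 * C₀) ≥ 0 := by positivity
  have hB0 : 0 ≤ B := by rw [hB]; positivity
  obtain ⟨X, hX⟩ : ∃ x : ℝ, x = B / (l' - 1) + 1 := ⟨_, rfl⟩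
  have hXB : l' * X = X + B + (l' - 1) := by
    have : (l' - 1) * X = B + (l' - 1) := by rw [hX]; field_simp
    linarith
  have hXlog : Real.log (3 * C₀) + 1 ≤ X := by
    have h1 : (l' - 1) * Real.log (3 * C₀) ≤ l' * Real.log (3 * C₀) :=
      mul_le_mul_of_nonneg_right (by linarith) hlog3C₀
    have h2 : Real.log (3 * C₀) ≤ B / (l' - 1) := by
      rw [le_div_iff₀ hl'1, hB]; linarith
    rw [hX]; linarith
  have hXpos : 0 < X := by linarith
  obtain ⟨ρ₁, hρ₁⟩ : ∃ r : ℝ, r = ρ * Real.exp (-X) := ⟨_, rfl⟩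
  have hρ₁pos : 0 < ρ₁ := by rw [hρ₁]; exact mul_pos hρ (Real.exp_pos _)
  have hexp_le : Real.exp (-X) ≤ (3 * C₀ * Real.exp 1)⁻¹ := by
    rw [← Real.exp_log (by positivity : 0 < 3 * C₀ * Real.exp 1), ← Real.exp_neg, Real.exp_le_exp,
      Real.log_mul (by positivity) (Real.exp_pos 1).ne', Real.log_exp]
    linarith
  have hCρ₁ : C₀ * ρ₁ < ρ / 3 := by
    have he : (2 : ℝ) ≤ Real.exp 1 := by linarith [Real.add_one_le_exp (1 : ℝ)]
    have h1 : C₀ * ρ₁ ≤ ρ * (3 * Real.exp 1)⁻¹ := by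
      rw [hρ₁]
      calc C₀ * (ρ * Real.exp (-X)) ≤ C₀ * (ρ * (3 * C₀ * Real.exp 1)⁻¹) := by gcongr
        _ = ρ * (3 * Real.exp 1)⁻¹ := by field_simp
    have h2 : ρ * (3 * Real.exp 1)⁻¹ < ρ / 3 := by
      rw [div_eq_mul_inv]
      exact mul_lt_mul_of_pos_left ((inv_lt_inv₀ (by positivity) (by norm_num)).2 (by linarith)) hρ
    linarith
  have hρ₁ρ : ρ₁ < ρ := by
    have : ρ₁ ≤ C₀ * ρ₁ := le_mul_of_one_le_left hρ₁pos.le hC₀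
    linarith
  have hρ₁ε : ρ₁ < ε₀ := hρ₁ρ.trans hρε
  have hlogρ₁ : Real.log ρ₁ = Real.log ρ - X := by
    rw [hρ₁, Real.log_mul hρ.ne' (Real.exp_pos _).ne', Real.log_exp]; ring
  -- profiles at scale `ρ₁`
  obtain ⟨s₀, hs₀⟩ : ∃ x : ℝ, x = Real.log ρ₁ - 2 := ⟨_, rfl⟩
  have hs₀ρ₁ : s₀ + 1 ≤ Real.log ρ₁ - 1 := by rw [hs₀]; linarith
  have hs₀ρ : s₀ + 1 ≤ Real.log ρ - 1 := by
    have := Real.log_le_log hρ₁pos hρ₁ρ.le; rw [hs₀]; linarith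
  obtain ⟨h₁, hh₁⟩ := exists_isProfileTransition s₀ one_pos
  -- the weights (kept opaque): `Lo = l' w₁ - c'` radial (outer), `A₂ = ŵ₂` cylindrical (inner)
  obtain ⟨c', hc'⟩ : ∃ x : ℝ, x = l' * (Real.log C₀ + 3) + 2 := ⟨_, rfl⟩
  have hlC3 : 0 ≤ l' * (Real.log C₀ + 3) := by positivity
  obtain ⟨w₁, hw₁⟩ : ∃ f : V → ℝ, f = radialWeight h₁ s₀ 1 a := ⟨_, rfl⟩
  obtain ⟨w₂, hw₂⟩ : ∃ f : V → ℝ, f = fun y => radialWeight h₁ s₀ 1 b (ℓ y) := ⟨_, rfl⟩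
  obtain ⟨Lo, hLo⟩ : ∃ f : V → ℝ, f = fun y => l' * radialWeight h₁ s₀ 1 a y + -c' := ⟨_, rfl⟩
  obtain ⟨A₂, hA₂⟩ : ∃ f : V → ℝ, f = fun y => 1 * radialWeight h₁ s₀ 1 b (ℓ y) + 0 := ⟨_, rfl⟩
  obtain ⟨u, hu⟩ : ∃ f : V → ℝ, f = fun y => smoothMax 1 (Lo y) (A₂ y) := ⟨_, rfl⟩
  have hA₂w₂ : A₂ = w₂ := by rw [hA₂, hw₂]; funext y; ring
  have hLow₁ : ∀ y, Lo y = l' * w₁ y + -c' := fun y => by rw [hLo, hw₁]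
  have hw₁s : ContDiff ℝ ∞ w₁ := by rw [hw₁]; exact hh₁.contDiff_radialWeight a
  have hw₂s : ContDiff ℝ ∞ w₂ := by rw [hw₂]; exact hh₁.contDiff_radialWeight_comp ℓ b
  have hA₂s : ContDiff ℝ ∞ A₂ := by rw [hA₂w₂]; exact hw₂s
  have hLos : ContDiff ℝ ∞ Lo := by
    rw [show Lo = fun y => l' * w₁ y + -c' from funext hLow₁]
    exact (contDiff_const.mul hw₁s).add contDiff_const
  have hus : ContDiff ℝ ∞ u := by rw [hu]; exact (contDiff_smoothMax (η := 1)).comp (hLos.prodMk hA₂s)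
  -- value bounds
  have hlog_norm_sq : ∀ x : ℝ, Real.log (x ^ 2) / 2 = Real.log x := fun x => by
    rw [Real.log_pow]; push_cast; ring
  have hw₂0 : ∀ z, 0 ≤ w₂ z := fun z => by rw [hw₂]; exact hh₁.profileWeight_nonneg _
  have hw₁le : ∀ z, w₁ z ≤ max 0 (Real.log ‖z - a‖ - s₀ - 1) + 2 := fun z => by
    have := hh₁.profileWeight_le (‖z - a‖ ^ 2)
    rw [hlog_norm_sq] at this
    rw [hw₁, radialWeight]; linarith
  have hw₂le : ∀ z, w₂ z ≤ max 0 (Real.log ‖ℓ z - b‖ - s₀ - 1) + 2 := fun z => by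
    have := hh₁.profileWeight_le (‖ℓ z - b‖ ^ 2)
    rw [hlog_norm_sq] at this
    rw [hw₂]; simp only [radialWeight]; linarith
  have hw₁ge : ∀ z, z ≠ a → Real.log ‖z - a‖ - s₀ - 1 ≤ w₁ z := fun z hz => by
    have hpos : 0 < ‖z - a‖ ^ 2 := pow_pos (norm_pos_iff.2 (sub_ne_zero.2 hz)) 2
    have := hh₁.profileWeight_ge hpos
    rw [hlog_norm_sq] at this
    rw [hw₁, radialWeight]; linarith
  have hℓza : ∀ z, ‖ℓ z - b‖ ≤ Cℓ * ‖z - a‖ := fun z => by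
    rw [hb, ← map_sub]
    exact (ℓ.le_opNorm _).trans (mul_le_mul_of_nonneg_right hℓle (norm_nonneg _))
  have hw₁a : ∀ z, z = a → w₁ z = 0 := fun z hz => by
    rw [hw₁, radialWeight, hz, sub_self, norm_zero, zero_pow two_ne_zero]
    exact IsProfileTransition.profileWeight_of_nonpos le_rfl
  have hw₂b : ∀ z, ℓ z = b → w₂ z = 0 := fun z hz => by
    rw [hw₂]
    simp only [radialWeight]
    rw [hz, sub_self, norm_zero, zero_pow two_ne_zero]
    exact IsProfileTransition.profileWeight_of_nonpos le_rfl
  -- (h2'): at carrier points over the base ball `B(b, ρ₁)`, `Lo ≤ -2 < A₂ - 1`, and they lie in `B(a, ρ/3)`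
  have hinner : ∀ z ∈ T.carrier ∩ U, ‖ℓ z - b‖ < ρ₁ → ‖z - a‖ < ρ / 3 ∧ Lo z + 1 < A₂ z := by
    rintro z hz hzρ₁
    have hza : ‖z - a‖ ≤ C₀ * ρ₁ := (hcone z hz).trans (mul_le_mul_of_nonneg_left hzρ₁.le hC₀pos.le)
    refine ⟨by linarith, ?_⟩
    have hLo_le : Lo z ≤ -2 := by
      rw [hLow₁]
      by_cases hza0 : z = a
      · rw [hw₁a z hza0, mul_zero, zero_add, hc']; linarith
      · have h1 : Real.log ‖z - a‖ ≤ Real.log C₀ + Real.log ρ₁ := by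
          rw [← Real.log_mul hC₀pos.ne' hρ₁pos.ne']
          exact Real.log_le_log (norm_pos_iff.2 (sub_ne_zero.2 hza0)) hza
        have hmax : max 0 (Real.log ‖z - a‖ - s₀ - 1) ≤ Real.log C₀ + 1 :=
          max_le (by linarith) (by rw [hs₀]; linarith)
        have h2 : w₁ z ≤ Real.log C₀ + 3 := (hw₁le z).trans (by linarith)
        have h3 : l' * w₁ z ≤ l' * (Real.log C₀ + 3) := mul_le_mul_of_nonneg_left h2 hl'0.le
        rw [hc']; linarith
    rw [hA₂w₂]; linarith [hw₂0 z]
  -- (h3'): on the shell `ρ/3 < ‖z - a‖ < ρ` (ambient), `A₂ + 1 < Lo`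
  have houter : ∀ z, ρ / 3 < ‖z - a‖ → ‖z - a‖ < ρ → A₂ z + 1 < Lo z := by
    intro z hzlo hzhi
    have hza0 : z ≠ a := fun h => by rw [h, sub_self, norm_zero] at hzlo; linarith
    have hposX : 0 ≤ Real.log Cℓ + X + 3 := by positivity
    have hA₂_le : A₂ z ≤ Real.log Cℓ + X + 3 := by
      rw [hA₂w₂]
      by_cases hzb : ℓ z = b
      · rw [hw₂b z hzb]; exact hposX
      · refine (hw₂le z).trans ?_
        have h1 : Real.log ‖ℓ z - b‖ ≤ Real.log Cℓ + Real.log ρ := by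
          rw [← Real.log_mul hCℓpos.ne' hρ.ne']
          exact Real.log_le_log (norm_pos_iff.2 (sub_ne_zero.2 hzb))
            ((hℓza z).trans (mul_le_mul_of_nonneg_left hzhi.le hCℓpos.le))
        have hmax : max 0 (Real.log ‖ℓ z - b‖ - s₀ - 1) ≤ Real.log Cℓ + X + 1 :=
          max_le (by positivity) (by rw [hs₀, hlogρ₁]; linarith)
        linarith
    have hLo_ge : l' * X - l' * Real.log (3 * C₀) - 2 * l' - 2 ≤ Lo z := by
      have h1 : Real.log (ρ / 3) ≤ Real.log ‖z - a‖ := Real.log_le_log (by positivity) hzlo.le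
      rw [Real.log_div hρ.ne' (by norm_num)] at h1
      have h2 : Real.log ρ - Real.log 3 - s₀ - 1 ≤ w₁ z := by linarith [hw₁ge z hza0]
      rw [hs₀, hlogρ₁] at h2
      have h3 : X - Real.log 3 + 1 ≤ w₁ z := by linarith
      have h4 : l' * (X - Real.log 3 + 1) ≤ l' * w₁ z := mul_le_mul_of_nonneg_left h3 hl'0.le
      rw [hLow₁, hc', Real.log_mul (by norm_num) hC₀pos.ne']
      nlinarith [h4]
    rw [hB] at hXB
    linarith
  -- the sets: `U' = B(a, ρ)`, `K = 𝐁(a, ρ/3)`, `S = U ∩ ℓ⁻¹ B(b, ρ₁) ∩ B(a, ρ)`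
  obtain ⟨S, hS⟩ : ∃ W : Set V, W = (U ∩ ℓ ⁻¹' ball b ρ₁) ∩ ball a ρ := ⟨_, rfl⟩
  have hSm : MeasurableSet S := by
    rw [hS]; exact (hUo.measurableSet.inter (measurableSet_ball.preimage ℓ.continuous.measurable)).inter
      measurableSet_ball
  have hSU' : S ⊆ ball a ρ := by rw [hS]; exact inter_subset_right
  have hSmem : ∀ {z}, z ∈ S ↔ (z ∈ U ∧ ‖ℓ z - b‖ < ρ₁) ∧ ‖z - a‖ < ρ := fun {z} => by
    rw [hS]; simp [dist_eq_norm]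
  have hcarS : T.carrier ∩ S = T.carrier ∩ U ∩ ℓ ⁻¹' ball b ρ₁ := by
    ext z
    simp only [mem_inter_iff, mem_preimage, mem_ball, dist_eq_norm]
    constructor
    · rintro ⟨hzc, hzS⟩
      have h := hSmem.1 hzS
      exact ⟨⟨hzc, h.1.1⟩, h.1.2⟩
    · rintro ⟨⟨hzc, hzU⟩, hzb⟩
      exact ⟨hzc, hSmem.2 ⟨⟨hzU, hzb⟩, by linarith [(hinner z ⟨hzc, hzU⟩ hzb).1]⟩⟩
  -- integrability over `reg A ∩ B(a, ρ)`
  have hintB : ∀ {w : V → ℝ}, ContDiff ℝ ∞ w →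
      IntegrableOn (fun z => (ddcForm w z).twoPow (q + 1) (T.orientationFrame z)) (T.carrier ∩ ball a ρ)
        (μHE[2 * (q + 1)] : Measure V) := fun hw =>
    T.integrableOn_twoPow_ddcForm_of_subset_compact hw (isCompact_closedBall a ρ) hρΩ ball_subset_closedBall
      measurableSet_ball
  -- the comparison inequality
  have hpsh : ∀ z ∈ T.carrier, 0 ≤ (ddcForm u z).twoPow (q + 1) (T.orientationFrame z) := by
    intro z hz
    rw [hu, hLo, hA₂]
    exact T.twoPow_ddcForm_smoothMax_nonneg hh₁ hh₁ a ℓ b hl'0.le zero_le_one (-c') 0 one_pos hz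
  have hcomp := setIntegral_twoPow_ddcForm_le_of_comparison hA (u := u) (φi := w₂) (φo := Lo) hus hLos
    isOpen_ball hUΩ' (isCompact_closedBall a (ρ / 3)) (closedBall_subset_ball (by linarith)) hSU' hSm hpsh
    (fun z hz => by
      have hz' := hSmem.1 hz.2
      have h := smoothMax_eventuallyEq_right one_pos hLos.continuous hA₂s.continuous
        (hinner z ⟨hz.1, hz'.1.1⟩ hz'.1.2).2
      rw [← hu, hA₂w₂] at h; exact h)
    (fun z hz hzK => by
      have hlo : ρ / 3 < ‖z - a‖ := by
        by_contra hle
        rw [not_lt] at hle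
        exact hzK (by rw [mem_closedBall, dist_eq_norm]; exact hle)
      have hhi : ‖z - a‖ < ρ := by simpa [dist_eq_norm] using hz.2
      have h := smoothMax_eventuallyEq_left one_pos hLos.continuous hA₂s.continuous (houter z hlo hhi)
      rw [← hu] at h; exact h)
    (hintB hus) (hintB hLos)
  -- evaluate the left-hand side: `k cq cK`
  obtain ⟨-, hcylv⟩ := hcyl ρ₁ hρ₁pos hρ₁ε h₁ s₀ 1 hh₁ hs₀ρ₁
  have hLHS : ∫ z in T.carrier ∩ S, (ddcForm w₂ z).twoPow (q + 1) (T.orientationFrame z)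
      ∂(μHE[2 * (q + 1)] : Measure V) = k * (cq * cK) := by
    rw [hcarS, hw₂]; exact hcylv
  -- evaluate the right-hand side: `l'^{q+1} ∫ MA(w₁)`
  have hRHS : ∫ z in T.carrier ∩ ball a ρ, (ddcForm Lo z).twoPow (q + 1) (T.orientationFrame z)
      ∂(μHE[2 * (q + 1)] : Measure V) =
      l' ^ (q + 1) * ∫ z in T.carrier ∩ ball a ρ, (ddcForm w₁ z).twoPow (q + 1) (T.orientationFrame z)
        ∂(μHE[2 * (q + 1)] : Measure V) := by
    rw [show (fun z => (ddcForm Lo z).twoPow (q + 1) (T.orientationFrame z)) =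
        fun z => l' ^ (q + 1) * (ddcForm w₁ z).twoPow (q + 1) (T.orientationFrame z) from funext fun z => by
      rw [hLo, hw₁]
      exact twoPow_ddcForm_const_mul_add_const_apply
        ((hh₁.contDiff_radialWeight a).of_le (by norm_cast)) l' (-c') z (q + 1) _]
    exact integral_const_mul (l' ^ (q + 1)) _
  have hdat := hdata h₁ s₀ 1 hh₁ hs₀ρ
  rw [← hw₁] at hdat
  -- combine
  have hreal : k * cK ≤ l' ^ (q + 1) * (cq⁻¹ * ∫ z in T.carrier ∩ ball a ρ,
      (ddcForm w₁ z).twoPow (q + 1) (T.orientationFrame z) ∂(μHE[2 * (q + 1)] : Measure V)) := by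
    have h1 : k * (cq * cK) ≤ l' ^ (q + 1) * ∫ z in T.carrier ∩ ball a ρ,
        (ddcForm w₁ z).twoPow (q + 1) (T.orientationFrame z) ∂(μHE[2 * (q + 1)] : Measure V) := by
      rw [← hLHS, ← hRHS]; exact hcomp
    have h2 : k * cK = cq⁻¹ * (k * (cq * cK)) := by field_simp
    rw [h2]
    calc cq⁻¹ * (k * (cq * cK)) ≤ cq⁻¹ * (l' ^ (q + 1) * ∫ z in T.carrier ∩ ball a ρ,
          (ddcForm w₁ z).twoPow (q + 1) (T.orientationFrame z) ∂(μHE[2 * (q + 1)] : Measure V)) :=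
          mul_le_mul_of_nonneg_left h1 (inv_nonneg.2 hcq_pos.le)
      _ = _ := by ring
  calc ENNReal.ofReal (k * cK) ≤ ENNReal.ofReal (l' ^ (q + 1) * (cq⁻¹ * ∫ z in T.carrier ∩ ball a ρ,
        (ddcForm w₁ z).twoPow (q + 1) (T.orientationFrame z) ∂(μHE[2 * (q + 1)] : Measure V))) :=
        ENNReal.ofReal_le_ofReal hreal
    _ = ENNReal.ofReal (l' ^ (q + 1)) * _ := by rw [ENNReal.ofReal_mul (by positivity), hdat]

end Lower

end HolomorphicChain

end Literature.Geometry.Kaehler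

end
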